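import Summits.QuantumFields.YangMills.Theorems.AllWindowsColdBoxBoxHighLineActionSandwichPlaquette

/-!
# TASK T-S5.6a `ActionSandwich`, brick 2: the plaquette cost of four Pauli-chart links, to second order (sinc-rescaled variables)

Planner ym-idea-2 g18 (2026-08-29T18:56:41Z; ✓`…Step2Defs` T-S5.6a, owner w2).  The link from ✓brick 1 (`…ActionSandwichPlaquette`:
the trace polynomial `re_trace_quad` and its estimate `abs_cost_sub_dot_le`) to the chart points `U_i = expPauli a_i`:
* `coe_expPauli_eq_cos_add` / `coe_expPauli_inv_eq_cos_sub` — `↑(expPauli a)^{±1} = cos‖a‖·1 ± X(sinc‖a‖·a)` (✓`coe_expPauli_eq`);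
* `sinc_smul_dot_self` — `|sinc‖a‖·a|² = 1 − cos²‖a‖`;
* ★ **`abs_plaquetteCost_sub_dot_le`** — for `‖a_i‖ ≤ t ≤ 1`, with `p_i = sinc‖a_i‖·a_i` and `s = p₁ + p₂ − p₃ − p₄`:
  `|2 − Re tr(U₁U₂U₃⁻¹U₄⁻¹) − s·s| ≤ 2t·|s|·Σ‖a_i‖ + 11t²·Σ‖a_i‖²` — the CUBIC error carries the factor `|s|` (circulation), the rest is
  `O(t²)·Σ‖a_i‖²`.
NEXT (same task): `|s − (a₁+a₂−a₃−a₄)| ≤ (t²/6)Σ‖a_i‖` (✓`abs_sinc_sub_one_le`) to pass to the true circulation, then the sum over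
`plaquettesTouching (boxEdges 4 (2H+1))` = the Hodge plaquettes, Cauchy–Schwarz, and ✓S1 `stub_hodgePoincare` (`Σ‖a_e‖² ≤ (H²/c)·boxQuadForm`)
for the relative `C·t·H` of `ActionSandwich`; the `landauPhi` half via ✓`landauPhi_eq_sum_gradVec_sq` + `imVec ∘ expPauli = sinc·P`.

HONEST LABEL: one brick of T-S5.6a (support task of STEP 2 of the XL stub S5); S5, U5, ⟨24004⟩ ⟨24335⟩ ⟨24336⟩ remain OPEN; no crux, rung or
summit is proved; the Yang–Mills mass gap is NOT proved by this file.
-/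

set_option autoImplicit false

noncomputable section

open Matrix Finset
open Literature.MathematicalPhysics.QuantumFieldTheory.Balaban1983to89.B10Eq18SigmaSU2 (su2Coord)
open Literature.MathematicalPhysics.QuantumFieldTheory.Balaban1983to89.B10Eq18SigmaSU2Haar (expPauli)

namespace Summit.QuantumFields.YangMills.Theorems.AllWindowsColdBoxBoxHighLine

namespace PlaqCost

/-! ## The link to the chart points `expPauli a` -/

/-- `↑(expPauli a) = cos‖a‖·1 + X(sinc‖a‖·a)`. -/
theorem coe_expPauli_eq_cos_add (a : EuclideanSpace ℝ (Fin 3)) :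
    ((expPauli a : SU2) : Matrix (Fin 2) (Fin 2) ℂ) =
      (Real.cos ‖a‖ : ℂ) • (1 : Matrix (Fin 2) (Fin 2) ℂ) + su2Coord (Real.sinc ‖a‖ • WithLp.ofLp a) := by
  have h : su2Coord (Real.sinc ‖a‖ • WithLp.ofLp a) = (Real.sinc ‖a‖ : ℂ) • su2Coord (WithLp.ofLp a) := by
    ext i j; fin_cases i <;> fin_cases j <;> simp [su2Coord] <;> ring
  rw [h, coe_expPauli_eq]

/-- `↑((expPauli a)⁻¹) = cos‖a‖·1 − X(sinc‖a‖·a)`. -/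
theorem coe_expPauli_inv_eq_cos_sub (a : EuclideanSpace ℝ (Fin 3)) :
    (((expPauli a)⁻¹ : SU2) : Matrix (Fin 2) (Fin 2) ℂ) =
      (Real.cos ‖a‖ : ℂ) • (1 : Matrix (Fin 2) (Fin 2) ℂ) - su2Coord (Real.sinc ‖a‖ • WithLp.ofLp a) := by
  have h : su2Coord (Real.sinc ‖a‖ • WithLp.ofLp a) = (Real.sinc ‖a‖ : ℂ) • su2Coord (WithLp.ofLp a) := by
    ext i j; fin_cases i <;> fin_cases j <;> simp [su2Coord] <;> ring
  rw [h, coe_expPauli_inv_eq]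

/-- `|sinc‖a‖·a|² = sin²‖a‖ = 1 − cos²‖a‖`. -/
theorem sinc_smul_dot_self (a : EuclideanSpace ℝ (Fin 3)) :
    (Real.sinc ‖a‖ • WithLp.ofLp a) ⬝ᵥ (Real.sinc ‖a‖ • WithLp.ofLp a) = 1 - Real.cos ‖a‖ ^ 2 := by
  have h1 : WithLp.ofLp a ⬝ᵥ WithLp.ofLp a = ‖a‖ ^ 2 := by
    rw [EuclideanSpace.norm_sq_eq]
    simp only [dotProduct, Real.norm_eq_abs, sq, abs_mul_abs_self]
  rw [smul_dotProduct, dotProduct_smul, smul_eq_mul, smul_eq_mul, h1]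
  have h2 : Real.sinc ‖a‖ * ‖a‖ = Real.sin ‖a‖ := by
    by_cases h : ‖a‖ = 0
    · rw [h, Real.sin_zero, mul_zero]
    · rw [Real.sinc_of_ne_zero h, div_mul_cancel₀ _ h]
  have h3 := Real.sin_sq_add_cos_sq ‖a‖
  calc Real.sinc ‖a‖ * (Real.sinc ‖a‖ * ‖a‖ ^ 2) = (Real.sinc ‖a‖ * ‖a‖) ^ 2 := by ring
    _ = 1 - Real.cos ‖a‖ ^ 2 := by rw [h2]; linarith

/-- ★ **The plaquette cost in the Pauli chart, to second order** (in the `sinc`-rescaled variables `p_i = sinc‖a_i‖·a_i`): for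
`‖a_i‖ ≤ t ≤ 1` and `s = p₁ + p₂ − p₃ − p₄`,
`|2 − Re tr(U₁U₂U₃⁻¹U₄⁻¹) − s·s| ≤ 2t·|s|·Σ‖a_i‖ + 11t²·Σ‖a_i‖²`, `U_i = expPauli a_i`. -/
theorem abs_plaquetteCost_sub_dot_le (a₁ a₂ a₃ a₄ : EuclideanSpace ℝ (Fin 3)) {t : ℝ} (ht : t ≤ 1)
    (h₁ : ‖a₁‖ ≤ t) (h₂ : ‖a₂‖ ≤ t) (h₃ : ‖a₃‖ ≤ t) (h₄ : ‖a₄‖ ≤ t) :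
    |2 - (((expPauli a₁ * expPauli a₂ * (expPauli a₃)⁻¹ * (expPauli a₄)⁻¹ : SU2) : Matrix (Fin 2) (Fin 2) ℂ)).trace.re
      - (Real.sinc ‖a₁‖ • WithLp.ofLp a₁ + Real.sinc ‖a₂‖ • WithLp.ofLp a₂ - Real.sinc ‖a₃‖ • WithLp.ofLp a₃
          - Real.sinc ‖a₄‖ • WithLp.ofLp a₄) ⬝ᵥ
        (Real.sinc ‖a₁‖ • WithLp.ofLp a₁ + Real.sinc ‖a₂‖ • WithLp.ofLp a₂ - Real.sinc ‖a₃‖ • WithLp.ofLp a₃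
          - Real.sinc ‖a₄‖ • WithLp.ofLp a₄)| ≤
      2 * t * Real.sqrt ((Real.sinc ‖a₁‖ • WithLp.ofLp a₁ + Real.sinc ‖a₂‖ • WithLp.ofLp a₂ - Real.sinc ‖a₃‖ • WithLp.ofLp a₃
          - Real.sinc ‖a₄‖ • WithLp.ofLp a₄) ⬝ᵥ
        (Real.sinc ‖a₁‖ • WithLp.ofLp a₁ + Real.sinc ‖a₂‖ • WithLp.ofLp a₂ - Real.sinc ‖a₃‖ • WithLp.ofLp a₃
          - Real.sinc ‖a₄‖ • WithLp.ofLp a₄)) * (‖a₁‖ + ‖a₂‖ + ‖a₃‖ + ‖a₄‖)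
        + 11 * t ^ 2 * (‖a₁‖ ^ 2 + ‖a₂‖ ^ 2 + ‖a₃‖ ^ 2 + ‖a₄‖ ^ 2) := by
  have hmul : ∀ x y : SU2, ((x * y : SU2) : Matrix (Fin 2) (Fin 2) ℂ) = (x : Matrix (Fin 2) (Fin 2) ℂ) * (y : Matrix (Fin 2) (Fin 2) ℂ) :=
    fun _ _ => rfl
  rw [hmul, hmul, hmul, coe_expPauli_eq_cos_add, coe_expPauli_eq_cos_add, coe_expPauli_inv_eq_cos_sub, coe_expPauli_inv_eq_cos_sub,
    re_trace_quad]
  exact abs_cost_sub_dot_le _ _ _ _ _ _ _ _ ht h₁ h₂ h₃ h₄ (norm_nonneg _) (norm_nonneg _) (norm_nonneg _) (norm_nonneg _)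
    (Real.one_sub_sq_div_two_le_cos) (Real.one_sub_sq_div_two_le_cos) (Real.one_sub_sq_div_two_le_cos)
    (Real.one_sub_sq_div_two_le_cos) (Real.cos_le_one _) (Real.cos_le_one _) (Real.cos_le_one _) (Real.cos_le_one _)
    (sinc_smul_dot_self a₁) (sinc_smul_dot_self a₂) (sinc_smul_dot_self a₃) (sinc_smul_dot_self a₄)

end PlaqCost

end Summit.QuantumFields.YangMills.Theorems.AllWindowsColdBoxBoxHighLine

end
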